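import Summits.QuantumFields.YangMills.Theorems.BalabanUVNodesN15KingModelContinuumSymbol
import Summits.QuantumFields.YangMills.Theorems.BalabanUVNodesN15KingModelBlockCovarianceFourier

/-!
# BalabanUVNodes ∕ N15 — THE KING-MODEL RUNG (PART Ϡ-e): THE `K → ∞` LIMIT OF NE2's UNIT-LAYER KERNEL IN CLOSED FORM —
# `(Δ^{(K)})⁻¹(b, b′) → C^{(∞)}(b, b′) := a_∞⁻¹·[b = b′] + |Ω|⁻¹ Σ_{q ∈ Ω̂} S_∞(p′(q))·Re e^{iq·(b′ − b)}`, AND THE (4.38)-SHAPE AGAINST THE EXPLICIT LIMIT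
# `|(Δ^{(K)})⁻¹(b, b′) − C^{(∞)}(b, b′)| ≤ 2C_diff·e^{−(κ_M∕2)|b − b′|}·L^{−K}`
# (Track A, DAG node N15 = NE2; FAN-OUT v1.1 §N15 s3 «KING-MODEL RUNG … NE2's analogue DECIDED in the model»)

HONEST FRAMING.  Count-neutral (cell `pub-ymgap`, seat `pub-ymgap-dag-n15-e` g32; `--supports stmt-QuantumFields-27366 --as helper` = K3⁸
`SpineGivenEndpointR13SepCoPHV`).  TEMPLATE LITERATURE: C. King, *The U(1) Higgs model. I. The continuum limit*, Commun. Math. Phys. **102** (1986) 649–677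
[King1986] — KING's OWN `A = 0` MODEL on the unit torus `Ω = Tor M`: the block-field covariance `(Δ^{(K)})⁻¹` ((2.13)–(2.14) p. 653, (4.5) p. 670; the rung's g0
`blockCov`), its two-spacing rate (Lemma 4.5's mechanism (4.39)–(4.41) pp. 674–675 for `Δ^{(k)}` alone; tree `King1986.Torus.effLaplacian_inv_sub_decay`, the g0
`blockCov_step_le`), and Thm 2.1 (i)'s shape «∃ lim_{K→∞}» (p. 654).  NOT Bałaban's `C^{(k)}(Λ)` of [B9]; NOT a node discharge (N15 is booked through n15-a's
knit, untouched here); nothing continuum-Yang–Mills ∕ ℝ⁴ ∕ OS ∕ mass-gap ∕ Clay.  0 `sorry`; standard axioms; ONE plumbing `def` (`blockCovLim`, the explicit limit).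

THE MATHEMATICS.  Part Ϡ-d: `(Δ^{(K)})⁻¹(b, b′) = a_K⁻¹[b = b′] + |Ω|⁻¹Σ_q S_K(q)Re e^{iq·(b′−b)}` EXACTLY at every level (`N = L^K`).  Part Ϡ-c: `a_K → a_∞ =
a(1 − L⁻²)` and `S_K(q) → S_∞(p′(q)) = Σ_{j ∈ ℤ^d}|u⁰(p′+2πj)|²∕(|p′+2πj|² + m²)` (Tannery over King's alias digits, `L` odd).  A finite sum of convergent sequences
converges: `(Δ^{(K)})⁻¹(b, b′) → C^{(∞)}(b, b′)` with `C^{(∞)}` THE EXPLICIT FUNCTION `blockCovLim` — white noise of strength `a_∞⁻¹` plus the unit-block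
averages of the CONTINUUM massive free propagator on the torus in King's plane waves (§1–§2).  The g0 two-spacing rate `|(Δ^{(K+1)})⁻¹ − (Δ^{(K)})⁻¹| ≤
C_diff L^{−K}e^{−(κ_M∕2)|b−b′|}` is geometric, so (Mathlib `dist_le_of_le_geometric_of_tendsto` on the shifted sequence) the distance to the now-identified limit
is `≤ C_diff e^{−(κ_M∕2)|b−b′|}L^{−K}·L∕(L−1) ≤ 2C_diff e^{−(κ_M∕2)|b−b′|}L^{−K}` (§3): the (4.38) shape `|C^{(K)} − C^{(∞)}| ≤ CL^{−K}e^{−δ|x−y|}` of NE2's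
unit layer, in the model, AGAINST THE CLOSED-FORM LIMIT.

WHAT THIS FILE PROVES (kernel).  §1 `blockCovLim L M a m² b b′` (★ the explicit `C^{(∞)}`).  §2 ★★★ **`tendsto_blockCov`** (`(Δ^{(K)})⁻¹(b,b′) → C^{(∞)}(b,b′)` as
`K → ∞`; `L` odd `≥ 2`, `a, m² > 0`, EVERY unit torus `M` and sites `b, b′`).  §3 `blockCov_congrN` (spelling of `N`), ★ `abs_blockCov_succ_sub_le` (the g0 step
rate on a general unit torus, from `effLaplacian_inv_sub_decay`), ★★★ **`abs_blockCov_sub_lim_le`** (`|(Δ^{(K)})⁻¹(b,b′) − C^{(∞)}(b,b′)| ≤ 2·C_diff·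
e^{−(κ_M∕2)·tdistT(b,b′)}·(L^K)⁻¹`, every `K ≥ 1`) — on EVERY unit torus `M`, in particular the rung's King volumes `kingVol L j = (2L^m, …, 2L^m)`.

WHAT THE CURVED CASE ADDS (one line).  For Bałaban's `Δ^{(k)}(U)`, `G(U)` there is no plane-wave representation: the `K → ∞` limit of NE2's unit layer exists by
the η-rate telescoping alone (parts Β-e∕Β-h, g30) and has no closed form; at `U ≡ 1` it is `blockCovLim`.
HONEST SCOPE.  King's `A = 0` model, odd `L`, `a, m² > 0`, finite unit torus (`m` fixed); constants `C_diff = CdiffM`, `κ_M = kapM` of the tree, not optimised.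
N15 untouched; counts unmoved.  Locators: [King1986] Thm 2.1 (2.22) p.654, (2.13)–(2.14) p.653, (4.5) p.670, Lemma 4.3 (4.18) p.672, (4.32)–(4.34), Lemma 4.5
(4.38) p.674, (4.39)–(4.41) pp.674–675.
-/

noncomputable section

open scoped BigOperators
open Finset Filter Topology

namespace Summit.QuantumFields.YangMills.BalabanUVNodes.N15KingModelRung

open Literature.MathematicalPhysics.QuantumFieldTheory.Balaban1983to89.B5Prop11Plancherel (Tor fine chi sOf)
open Literature.MathematicalPhysics.QuantumFieldTheory.King1986 (aK aK_pos)
open Literature.MathematicalPhysics.QuantumFieldTheory.King1986.Torus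

variable {d : ℕ}

/-! ## §1 The explicit continuum block covariance -/

section Limit

variable (L : ℕ) (M : Fin (d + 1) → ℕ) [hM : ∀ μ, NeZero (M μ)]

/-- ★ **THE CONTINUUM BLOCK-FIELD COVARIANCE IN CLOSED FORM**: `C^{(∞)}(b, b′) := a_∞⁻¹·[b = b′] + |Ω|⁻¹ Σ_{q ∈ Ω̂} S_∞(p′(q))·Re e^{iq·(b′ − b)}`, `a_∞ =
a(1 − L⁻²)`, `S_∞(p′) = Σ_{j ∈ ℤ^d} |u⁰(p′+2πj)|²∕(|p′+2πj|² + m²)` — block-spin white noise plus the unit-block averages of the continuum massive free propagator on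
the torus `Ω`, in King's (4.5) plane waves at `η = 0`. [cite: King1986, (2.13)–(2.14) p.653, (4.5) p.670, Thm 2.1 (2.22) p.654] -/
def blockCovLim (a m2 : ℝ) (b b' : Tor M) : ℝ :=
  (aInf a L)⁻¹ * (if b = b' then 1 else 0)
    + (Fintype.card (Tor M) : ℝ)⁻¹ * ∑ q : Tor M, aliasSeries0 m2 (sOf M q) * (chi M q (b' - b)).re

/-! ## §2 The limit -/

/-- ★★★ **THE `K → ∞` LIMIT OF NE2's UNIT-LAYER KERNEL IN THE MODEL, IN CLOSED FORM**: for `L` odd, `L ≥ 2`, `a, m² > 0`, every unit torus `Ω = Π ℤ∕M_μ` and all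
unit sites `b, b′`, `(Δ^{(K)})⁻¹(b, b′) = blockCov L (L^K) M a m² K b b′ → C^{(∞)}(b, b′) = blockCovLim L M a m² b b′` as `K → ∞` — part Ϡ-d's exact plane-wave
formula term by term with part Ϡ-c's `a_K⁻¹ → a_∞⁻¹`, `S_{L^K}(q) → S_∞(p′(q))`. [cite: King1986, Thm 2.1 (2.22) p.654, (2.13)–(2.14) p.653, (4.5) p.670] -/
theorem tendsto_blockCov (hLodd : Odd L) (hL : 2 ≤ L) {a m2 : ℝ} (ha : 0 < a) (hm : 0 < m2) (b b' : Tor M) :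
    haveI : NeZero L := ⟨by omega⟩
    Tendsto (fun K : ℕ => blockCov L (L ^ K) M a m2 K b b') atTop (𝓝 (blockCovLim L M a m2 b b')) := by
  haveI : NeZero L := ⟨by omega⟩
  have hL1 : (1 : ℝ) < L := by exact_mod_cast (show 1 < L by omega)
  have hlim : Tendsto (fun K : ℕ => (aK a L K)⁻¹ * (if b = b' then (1 : ℝ) else 0)
        + (Fintype.card (Tor M) : ℝ)⁻¹ * ∑ q : Tor M, Sfib (L ^ K) M (((L ^ K : ℕ) : ℝ) ^ 2) m2 q * (chi M q (b' - b)).re)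
      atTop (𝓝 (blockCovLim L M a m2 b b')) := by
    unfold blockCovLim
    exact ((tendsto_inv_aK ha hL1).mul_const _).add
      (tendsto_const_nhds.mul (tendsto_finsetSum _ fun q _ => (tendsto_Sfib_pow L M hLodd hL hm q).mul_const _))
  refine hlim.congr' ?_
  filter_upwards [eventually_ge_atTop 1] with K hK
  exact (blockCov_pow_eq_fourier L hL M ha hm hK b b').symm

/-! ## §3 The (4.38)-shape against the explicit limit -/

/-- `blockCov` does not depend on the spelling of `N` (`L^{K+1}` versus `L·L^K`). [cite: King1986, (2.14) p.653] -/
theorem blockCov_congrN {N N' : ℕ} [NeZero N] [NeZero N'] (h : N = N') (a m2 : ℝ) (K : ℕ) (b b' : Tor M) :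
    blockCov L N M a m2 K b b' = blockCov L N' M a m2 K b b' := by
  subst h
  rfl

/-- ★ THE g0 STEP RATE ON A GENERAL UNIT TORUS: `|(Δ^{(K+1)})⁻¹(b,b′) − (Δ^{(K)})⁻¹(b,b′)| ≤ C_diff·(L^K)⁻¹·e^{−(κ_M∕2)·tdistT(b,b′)}` (`L ≥ 2`, `a, m² > 0`, `K ≥ 1`)
— the tree's `effLaplacian_inv_sub_decay` at `n = 1`. [cite: King1986, (4.39)–(4.41) pp.674–675, Lemma 4.3 (4.18) p.672] -/
theorem abs_blockCov_succ_sub_le (hL : 2 ≤ L) {a m2 : ℝ} (ha : 0 < a) (hm : 0 < m2) {K : ℕ} (hK : 1 ≤ K) (b b' : Tor M) :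
    haveI : NeZero L := ⟨by omega⟩
    |blockCov L (L ^ (K + 1)) M a m2 (K + 1) b b' - blockCov L (L ^ K) M a m2 K b b'|
      ≤ CdiffM (d + 1) a m2 L * ((L : ℝ) ^ K)⁻¹ * Real.exp (-(kapM (d + 1) a m2 L / 2 * tdistT M b b')) := by
  haveI : NeZero L := ⟨by omega⟩
  have h := effLaplacian_inv_sub_decay ha hm hL hK le_rfl M b b'
  rw [blockCov_congrN L M (show L ^ (K + 1) = L ^ 1 * L ^ K by ring) a m2 (K + 1) b b']
  unfold blockCov
  exact h

/-- ★★★ **NE2's (4.38)-SHAPE AGAINST THE CLOSED-FORM LIMIT**: for `L` odd, `L ≥ 2`, `a, m² > 0`, every unit torus, all unit sites and every `K ≥ 1`,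
`|(Δ^{(K)})⁻¹(b, b′) − C^{(∞)}(b, b′)| ≤ 2·C_diff·e^{−(κ_M∕2)·tdistT(b,b′)}·(L^K)⁻¹` — the geometric two-spacing steps summed to the identified limit
(`C_diff L^{−K}·L∕(L−1) ≤ 2C_diff L^{−K}`). [cite: King1986, Lemma 4.5 (4.38) p.674, (4.39)–(4.41) pp.674–675, Thm 2.1 (2.22) p.654] -/
theorem abs_blockCov_sub_lim_le (hLodd : Odd L) (hL : 2 ≤ L) {a m2 : ℝ} (ha : 0 < a) (hm : 0 < m2) {K : ℕ} (hK : 1 ≤ K) (b b' : Tor M) :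
    haveI : NeZero L := ⟨by omega⟩
    |blockCov L (L ^ K) M a m2 K b b' - blockCovLim L M a m2 b b'|
      ≤ 2 * CdiffM (d + 1) a m2 L * Real.exp (-(kapM (d + 1) a m2 L / 2 * tdistT M b b')) * ((L : ℝ) ^ K)⁻¹ := by
  haveI : NeZero L := ⟨by omega⟩
  set E := Real.exp (-(kapM (d + 1) a m2 L / 2 * tdistT M b b')) with hE
  set C := CdiffM (d + 1) a m2 L with hC
  set f : ℕ → ℝ := fun n => blockCov L (L ^ (n + 1)) M a m2 (n + 1) b b' with hf
  have hL1 : (1 : ℝ) < L := by exact_mod_cast (show 1 < L by omega)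
  have hLpos : (0 : ℝ) < L := by linarith
  have hr : ((L : ℝ))⁻¹ < 1 := inv_lt_one_of_one_lt₀ hL1
  have hC0 : 0 ≤ C := CdiffM_nonneg (d := d + 1) ha hm hL
  have hE0 : 0 < E := Real.exp_pos _
  have hstep : ∀ n, dist (f n) (f (n + 1)) ≤ C * E * ((L : ℝ))⁻¹ * (((L : ℝ))⁻¹) ^ n := by
    intro n
    rw [Real.dist_eq, abs_sub_comm]
    have h := abs_blockCov_succ_sub_le L M hL ha hm (K := n + 1) (by omega) b b'
    calc |blockCov L (L ^ (n + 1 + 1)) M a m2 (n + 1 + 1) b b' - blockCov L (L ^ (n + 1)) M a m2 (n + 1) b b'|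
        ≤ C * ((L : ℝ) ^ (n + 1))⁻¹ * E := h
      _ = C * E * ((L : ℝ))⁻¹ * (((L : ℝ))⁻¹) ^ n := by rw [pow_succ, mul_inv, inv_pow]; ring
  have hlim : Tendsto f atTop (𝓝 (blockCovLim L M a m2 b b')) :=
    (tendsto_blockCov L M hLodd hL ha hm b b').comp (tendsto_add_atTop_nat 1)
  have hgeo := dist_le_of_le_geometric_of_tendsto ((L : ℝ))⁻¹ (C * E * ((L : ℝ))⁻¹) hr hstep hlim (K - 1)
  have hfK : f (K - 1) = blockCov L (L ^ K) M a m2 K b b' := by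
    simp only [hf, Nat.sub_add_cancel hK]
  rw [hfK, Real.dist_eq] at hgeo
  have hden : 0 < 1 - ((L : ℝ))⁻¹ := by linarith
  have hLinv : ((L : ℝ))⁻¹ ≤ 2⁻¹ := inv_anti₀ two_pos (by exact_mod_cast hL)
  have hq : 1 / (1 - ((L : ℝ))⁻¹) ≤ 2 := by
    rw [div_le_iff₀ hden]
    linarith
  calc |blockCov L (L ^ K) M a m2 K b b' - blockCovLim L M a m2 b b'|
      ≤ C * E * ((L : ℝ))⁻¹ * (((L : ℝ))⁻¹) ^ (K - 1) / (1 - ((L : ℝ))⁻¹) := hgeo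
    _ = C * E * ((L : ℝ) ^ K)⁻¹ * (1 / (1 - ((L : ℝ))⁻¹)) := by
        have hpow : ((L : ℝ))⁻¹ * (((L : ℝ))⁻¹) ^ (K - 1) = ((L : ℝ) ^ K)⁻¹ := by
          rw [← pow_succ', Nat.sub_add_cancel hK, inv_pow]
        rw [← hpow]
        ring
    _ ≤ C * E * ((L : ℝ) ^ K)⁻¹ * 2 := by
        have h0 : 0 ≤ C * E * ((L : ℝ) ^ K)⁻¹ := by positivity
        exact mul_le_mul_of_nonneg_left hq h0
    _ = 2 * C * E * ((L : ℝ) ^ K)⁻¹ := by ring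

end Limit

end Summit.QuantumFields.YangMills.BalabanUVNodes.N15KingModelRung

end
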